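import Summits.Ventures.HodgeRepro.Night1ProductWeilLineEigen

/-!
# The Weil space of the full corner product in the `G`-set model: the span of the `σ`-lines is
canonical, of dimension `|G| = [F : ℚ]`, permuted by the Galois group, and contained in the joint
`(k, k)`-eigenspace of every conjugate cocharacter

Blind re-derivation cell `pub-hodge-repro`, seat `night-1` (gen 4).  Imports `Night1ProductWeilLineEigen`
(p376653: the `σ`-lines `weilWedgeProd e σ = e_{(e 0, σ)} ∧ ⋯ ∧ e_{(e (2k−1), σ)}` of the full corner
product `B = ∏_i A_{T i}` on the `G`-set `ι × G` of embeddings of its CM algebra `F^ι`, and their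
membership in the joint eigenspace for `SumP k` families).

Milne 2020 §2.1 (paper:arxiv-2010.08857 p0004:L3–10) defines `W_E(A) := ∧^d_E H¹(A, ℚ) ⊆ H^d(A, ℚ)`: a
one-dimensional `E`-vector space, hence a `ℚ`-space of dimension `[E : ℚ]`, on which `E ⊗_ℚ ℂ = ∏_σ ℂ`
acts through the `σ`-lines.  In the model the complexified Weil space is the span of the `|G|` lines:

* `lineDual e σ` — the functional `⟨e^*_{line σ}, ·⟩` (the pairing with the wedge of the coordinate
  projections of the `σ`-line); `lineDual_weilWedgeProd_self` (`= 1`) and `lineDual_weilWedgeProd_of_ne`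
  (`= 0` on every other line, `k ≥ 1`): the lines are separated by dual functionals;
* **`linearIndependent_weilWedgeProd`** — the `|G|` lines are linearly independent (`k ≥ 1`);
* `weilSpaceProd G k e := span ℂ {weilWedgeProd e σ : σ ∈ G}` — the Weil space; **`finrank_weilSpaceProd`**
  (`= |G|`); `weilSpaceProd_eq` — it does not depend on the enumeration `e` of the corners
  (`weilWedgeProd_eq_sign_smul`: two enumerations differ by the sign of the permutation);
* **`weilSpaceProd_le_jointEigenspaceOn`** — for a `SumP k` family of CM types the whole Weil space lies
  in the joint `(k, k)`-eigenspace of every Galois conjugate of the cocharacter (the span form of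
  p376653's `weilWedgeProd_mem_jointEigenspaceOn`), and **`weilSpaceProd_le_jointEigenspaceOn_iff_sumP`** —
  the converse holds too (Deligne's criterion as an equivalence: the Weil space is Hodge for every
  conjugate iff the family has constant sum);
* `galProd k g` — the Galois action on `⋀^{2k} ℂ^{ι × G}` by the coordinate permutation
  `(i, x) ↦ (i, g x)`; **`galProd_weilWedgeProd`** (`g` carries the `σ`-line to the `gσ`-line) and
  `map_galProd_weilSpaceProd` (the Weil space is Galois-stable: `G` permutes its lines simply
  transitively — the regular representation); `galProd_one` / `galProd_mul` (a group action) and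
  `map_galProd_jointEigenspaceOn_le` / `map_galProd_jointEigenspaceOn_eq` — the joint
  `(k, k)`-eigenspace of the product is Galois-stable (typer's `IsHodgeSetProd.prodSmul` through typer-2's span description
  `jointEigenspaceOn_prod_eq_span`).

The Hodge type of a single line: `map_cocharOn_weilWedgeProd` — `⋀^{2k} μ_T(λ)` scales the `σ`-line by
`λ^{m_σ}`, `m_σ = #{i : σ ∈ T i}` (type `(m_σ, 2k − m_σ)`); `(k, k)` for `μ_T` alone iff `m_σ = k`
(`forall_map_cocharOn_weilWedgeProd_eq_iff`); `SumP k T` = that for every `σ`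
(`sumP_iff_forall_map_cocharOn_weilWedgeProd_eq`).

Instances: every rank-four face on its full four-corner product, the level-3 family `B₃`, the decic witness.

Nothing geometric is built; every statement is about coordinate wedges on the finite `G`-set `ι × G`.
The `ℚ`-structure of `W_F(B)` (the trace form `Σ_σ σ(f) e_{line σ}`, `f ∈ F`) needs the field `F` and is
not modelled.  Nothing here says anything about the status of the Hodge conjecture for CM abelian
varieties, which is NOT proved.
-/

set_option autoImplicit false

open Finset Module
open scoped Pointwise

namespace HodgeRepro.RouteC

open CMHodgeOn

variable {G : Type*} [Group G] [DecidableEq G] [Fintype G] {ι : Type*} [Fintype ι] [DecidableEq ι]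

/-! ### The dual functional of a `σ`-line -/

omit [Group G] [Fintype G] [Fintype ι] in
/-- The functional `ω ↦ ⟨e^*_{line σ}, ω⟩`: the pairing of the wedge of the coordinate projections of the
`σ`-line `(e 0, σ), …, (e (2k−1), σ)` with `ω ∈ ⋀^{2k} ℂ^{ι × G}`. -/
noncomputable def lineDual {k : ℕ} (e : Fin (2 * k) ≃ ι) (σ : G) :
    Module.Dual ℂ (⋀[ℂ]^(2 * k) ((ι × G) → ℂ)) :=
  exteriorPower.pairingDual ℂ ((ι × G) → ℂ) (2 * k)
    (exteriorPower.ιMulti ℂ (2 * k) fun j => (LinearMap.proj (lineEnum e σ j) : ((ι × G) → ℂ) →ₗ[ℂ] ℂ))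

omit [Group G] [Fintype G] [Fintype ι] in
/-- The dual functional of the `σ`-line takes the value `1` on the `σ`-line. -/
theorem lineDual_weilWedgeProd_self {k : ℕ} (e : Fin (2 * k) ≃ ι) (σ : G) :
    lineDual e σ (weilWedgeProd e σ) = 1 :=
  pairingDual_proj_coordWedgeOn (lineEnum_injective e σ)

omit [Group G] [Fintype G] [Fintype ι] in
/-- The dual functional of the `σ`-line vanishes on every other line (`k ≥ 1`): no point of the `τ`-line
lies on the `σ`-line, so the pairing matrix is zero. -/
theorem lineDual_weilWedgeProd_of_ne {k : ℕ} (hk : 0 < k) (e : Fin (2 * k) ≃ ι) {σ τ : G}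
    (h : σ ≠ τ) : lineDual e σ (weilWedgeProd e τ) = 0 := by
  unfold lineDual weilWedgeProd coordWedgeOn
  rw [exteriorPower.pairingDual_ιMulti_ιMulti]
  refine Matrix.det_eq_zero_of_row_eq_zero ⟨0, by omega⟩ fun j => ?_
  rw [Matrix.of_apply, LinearMap.proj_apply, coordVecOn_apply, if_neg]
  intro hEq
  exact h (congrArg Prod.snd hEq)

omit [Group G] [Fintype G] [Fintype ι] in
/-- **The `σ`-lines are linearly independent** (`k ≥ 1`): they are separated by their dual
functionals. -/
theorem linearIndependent_weilWedgeProd {k : ℕ} (hk : 0 < k) (e : Fin (2 * k) ≃ ι) :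
    LinearIndependent ℂ fun σ : G => weilWedgeProd e σ :=
  LinearIndependent.of_pairwise_dual_eq_zero_one _ (lineDual e)
    (fun _ _ h => lineDual_weilWedgeProd_of_ne hk e h) (lineDual_weilWedgeProd_self e)

/-! ### The Weil space -/

omit [Group G] [Fintype G] [Fintype ι] in
variable (G) in
/-- **The Weil space of the full corner product** in the model: the span of the `|G|` lines
`weilWedgeProd e σ`, `σ ∈ G` (`W_F(B) ⊗ ℂ`, Milne 2020 §2.1). -/
noncomputable def weilSpaceProd (k : ℕ) (e : Fin (2 * k) ≃ ι) :
    Submodule ℂ (⋀[ℂ]^(2 * k) ((ι × G) → ℂ)) :=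
  Submodule.span ℂ (Set.range fun σ : G => weilWedgeProd e σ)

omit [Group G] [Fintype G] [Fintype ι] in
/-- Every `σ`-line lies in the Weil space. -/
theorem weilWedgeProd_mem_weilSpaceProd (k : ℕ) (e : Fin (2 * k) ≃ ι) (σ : G) :
    weilWedgeProd e σ ∈ weilSpaceProd G k e :=
  Submodule.subset_span ⟨σ, rfl⟩

omit [Group G] [Fintype ι] in
/-- **`dim_ℂ W_F(B) ⊗ ℂ = |G| = [F : ℚ]`** (`k ≥ 1`). -/
theorem finrank_weilSpaceProd {k : ℕ} (hk : 0 < k) (e : Fin (2 * k) ≃ ι) :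
    finrank ℂ (weilSpaceProd G k e) = Fintype.card G :=
  finrank_span_eq_card (linearIndependent_weilWedgeProd hk e)

omit [Group G] [DecidableEq G] [Fintype G] [Fintype ι] [DecidableEq ι] in
/-- Re-enumerating the corners: `lineEnum e' σ = lineEnum e σ ∘ (e' ∘ e⁻¹)`. -/
theorem lineEnum_eq_comp {n : ℕ} (e e' : Fin n ≃ ι) (σ : G) :
    lineEnum e' σ = lineEnum e σ ∘ (e'.trans e.symm) := by
  funext j
  simp [lineEnum]

omit [Group G] [Fintype G] [Fintype ι] in
/-- Two enumerations of the corners give the same `σ`-line up to the sign of the permutation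
`e' ∘ e⁻¹` of `Fin 2k`. -/
theorem weilWedgeProd_eq_sign_smul {k : ℕ} (e e' : Fin (2 * k) ≃ ι) (σ : G) :
    weilWedgeProd e' σ = ((Equiv.Perm.sign (e'.trans e.symm) : ℤ) : ℂ) • weilWedgeProd e σ := by
  unfold weilWedgeProd coordWedgeOn
  rw [lineEnum_eq_comp e e' σ]
  rw [show (fun j => coordVecOn ((lineEnum e σ ∘ ⇑(e'.trans e.symm)) j)) =
      (fun j => coordVecOn (lineEnum e σ j)) ∘ ⇑(e'.trans e.symm) from rfl,
    AlternatingMap.map_perm, Units.smul_def, ← Int.cast_smul_eq_zsmul ℂ]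

omit [Group G] [Fintype G] [Fintype ι] in
/-- **The Weil space is canonical**: it does not depend on the enumeration of the corners. -/
theorem weilSpaceProd_eq (k : ℕ) (e e' : Fin (2 * k) ≃ ι) :
    weilSpaceProd G k e' = weilSpaceProd G k e := by
  apply le_antisymm
  · rw [weilSpaceProd, Submodule.span_le]
    rintro _ ⟨σ, rfl⟩
    show weilWedgeProd e' σ ∈ weilSpaceProd G k e
    rw [weilWedgeProd_eq_sign_smul e e' σ]
    exact Submodule.smul_mem _ _ (weilWedgeProd_mem_weilSpaceProd k e σ)
  · rw [weilSpaceProd, Submodule.span_le]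
    rintro _ ⟨σ, rfl⟩
    show weilWedgeProd e σ ∈ weilSpaceProd G k e'
    rw [weilWedgeProd_eq_sign_smul e' e σ]
    exact Submodule.smul_mem _ _ (weilWedgeProd_mem_weilSpaceProd k e' σ)

/-- **The Weil space consists of `(k, k)`-classes of the product and of every Galois conjugate** — the
span form of the printed clause `WeilLine_Hodge` (Milne 2020 §2.2 / Deligne LNM 900 §5 (c)) on the
kernel: for a `SumP k` family `T` of CM types of `(G, c)` the Weil space lies in the joint
`λ^k`-eigenspace of `⋀^{2k} μ_{g • T}(λ)` for all `g ∈ G`, `λ ∈ ℂ`. -/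
theorem weilSpaceProd_le_jointEigenspaceOn {c : G} (hc : IsComplexConj c) {k : ℕ} {T : ι → Finset G}
    (hT : ∀ i, IsCMType c (T i)) (hsum : SumP k T) (e : Fin (2 * k) ≃ ι) :
    weilSpaceProd G k e ≤ jointEigenspaceOn (fun g : G => prodTypeSet fun i => g • T i) (2 * k) k := by
  rw [weilSpaceProd, Submodule.span_le]
  rintro _ ⟨σ, rfl⟩
  exact weilWedgeProd_mem_jointEigenspaceOn hc hT hsum e σ

/-- The converse at the space level: if the Weil space lies in the joint `(k, k)`-eigenspace then every
`σ`-line set is a Pohlmann set and the family has constant sum (p376653's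
`sumP_of_forall_isHodgeSetProd_lineSet`; `|ι| = 2k` through the enumeration). -/
theorem sumP_of_weilSpaceProd_le_jointEigenspaceOn {c : G} (hc : IsComplexConj c) {k : ℕ}
    {T : ι → Finset G} (hT : ∀ i, IsCMType c (T i)) (e : Fin (2 * k) ≃ ι)
    (h : weilSpaceProd G k e ≤ jointEigenspaceOn (fun g : G => prodTypeSet fun i => g • T i) (2 * k) k) :
    SumP k T := by
  have hk : Fintype.card ι / 2 = k := by
    rw [← Fintype.card_congr e, Fintype.card_fin]
    omega
  rw [← hk]
  refine sumP_of_forall_isHodgeSetProd_lineSet hc hT fun σ => ?_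
  rw [← image_lineEnum e σ]
  rw [isHodgeSetProd_iff_forall_map_cocharOn_eq hc hT (lineEnum_injective e σ)]
  have hσ := h (weilWedgeProd_mem_weilSpaceProd k e σ)
  rw [mem_jointEigenspaceOn_iff] at hσ
  exact hσ

/-- **Deligne's criterion for the Weil space** (Milne 2020 §2.1–2.2 / Deligne LNM 900 §5 (c), as an
equivalence on the kernel): for a family of CM types of `(G, c)` with `2k` corners, the Weil space of the
full product consists of joint `(k, k)`-classes for every Galois conjugate IFF `Σ_i φ_i(s) = k` for all
`s` (`SumP k`). -/
theorem weilSpaceProd_le_jointEigenspaceOn_iff_sumP {c : G} (hc : IsComplexConj c) {k : ℕ}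
    {T : ι → Finset G} (hT : ∀ i, IsCMType c (T i)) (e : Fin (2 * k) ≃ ι) :
    weilSpaceProd G k e ≤ jointEigenspaceOn (fun g : G => prodTypeSet fun i => g • T i) (2 * k) k ↔
      SumP k T :=
  ⟨sumP_of_weilSpaceProd_le_jointEigenspaceOn hc hT e,
    fun hsum => weilSpaceProd_le_jointEigenspaceOn hc hT hsum e⟩

/-! ### The Galois action: `G` permutes the lines -/

omit [DecidableEq G] [Fintype G] [Fintype ι] [DecidableEq ι] in
/-- The Galois action of `g ∈ G` on `ℂ^{ι × G}`: the coordinate permutation `(i, x) ↦ (i, g x)`. -/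
def galProdLin (g : G) : ((ι × G) → ℂ) →ₗ[ℂ] ((ι × G) → ℂ) :=
  LinearMap.funLeft ℂ ℂ fun q : ι × G => (q.1, g⁻¹ * q.2)

omit [DecidableEq G] [Fintype G] [Fintype ι] [DecidableEq ι] in
/-- `1 ∈ G` acts trivially on `ℂ^{ι × G}`. -/
theorem galProdLin_one : galProdLin (1 : G) = (LinearMap.id : ((ι × G) → ℂ) →ₗ[ℂ] ((ι × G) → ℂ)) := by
  ext f q
  simp [galProdLin, LinearMap.funLeft_apply]

omit [DecidableEq G] [Fintype G] [Fintype ι] [DecidableEq ι] in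
/-- The action on `ℂ^{ι × G}` is a group action: `gh` acts as `g` after `h`. -/
theorem galProdLin_mul (g h : G) :
    galProdLin (ι := ι) (g * h) = galProdLin (ι := ι) g ∘ₗ galProdLin (ι := ι) h := by
  ext f q
  simp [galProdLin, LinearMap.funLeft_apply, mul_assoc]

omit [Fintype G] [Fintype ι] in
/-- `g` carries the coordinate vector of `(i, x)` to that of `(i, g x)`. -/
theorem galProdLin_coordVecOn (g : G) (x : ι × G) :
    galProdLin g (coordVecOn x) = coordVecOn (x.1, g * x.2) := by
  funext q
  simp only [galProdLin, LinearMap.funLeft_apply, coordVecOn_apply]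
  have hiff : (q.1, g⁻¹ * q.2) = x ↔ q = (x.1, g * x.2) := by
    constructor
    · rintro rfl
      simp
    · rintro rfl
      simp
  rw [if_congr hiff rfl rfl]

omit [DecidableEq G] [Fintype G] [Fintype ι] [DecidableEq ι] in
/-- The Galois action of `g ∈ G` on `⋀^{2k} ℂ^{ι × G}`. -/
noncomputable def galProd (k : ℕ) (g : G) :
    ⋀[ℂ]^(2 * k) ((ι × G) → ℂ) →ₗ[ℂ] ⋀[ℂ]^(2 * k) ((ι × G) → ℂ) :=
  exteriorPower.map (2 * k) (galProdLin g)

omit [DecidableEq G] [Fintype G] [Fintype ι] [DecidableEq ι] in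
/-- `1 ∈ G` acts trivially on `⋀^{2k} ℂ^{ι × G}`. -/
theorem galProd_one (k : ℕ) : galProd (ι := ι) k (1 : G) = LinearMap.id := by
  rw [galProd, galProdLin_one, exteriorPower.map_id]

omit [DecidableEq G] [Fintype G] [Fintype ι] [DecidableEq ι] in
/-- The action on `⋀^{2k} ℂ^{ι × G}` is a group action: `galProd k (g h) = galProd k g ∘ galProd k h`. -/
theorem galProd_mul (k : ℕ) (g h : G) :
    galProd (ι := ι) k (g * h) = galProd (ι := ι) k g ∘ₗ galProd (ι := ι) k h := by
  rw [galProd, galProdLin_mul, exteriorPower.map_comp]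
  rfl

omit [Fintype G] [Fintype ι] in
/-- **`g` carries the `σ`-line to the `gσ`-line.** -/
theorem galProd_weilWedgeProd {k : ℕ} (g : G) (e : Fin (2 * k) ≃ ι) (σ : G) :
    galProd k g (weilWedgeProd e σ) = weilWedgeProd e (g * σ) := by
  unfold galProd weilWedgeProd coordWedgeOn
  rw [exteriorPower.map_apply_ιMulti]
  congr 1
  funext j
  rw [Function.comp_apply, galProdLin_coordVecOn]
  rfl

omit [Fintype G] [Fintype ι] in
/-- **The Weil space is Galois-stable**: `g` permutes its lines (the regular representation of `G`). -/
theorem map_galProd_weilSpaceProd {k : ℕ} (g : G) (e : Fin (2 * k) ≃ ι) :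
    (weilSpaceProd G k e).map (galProd k g) = weilSpaceProd G k e := by
  rw [weilSpaceProd, Submodule.map_span]
  congr 1
  ext ω
  constructor
  · rintro ⟨_, ⟨σ, rfl⟩, rfl⟩
    exact ⟨g * σ, (galProd_weilWedgeProd g e σ).symm⟩
  · rintro ⟨σ, rfl⟩
    refine ⟨weilWedgeProd e (g⁻¹ * σ), ⟨g⁻¹ * σ, rfl⟩, ?_⟩
    rw [galProd_weilWedgeProd, mul_inv_cancel_left]

omit [Fintype G] [Fintype ι] in
/-- `g` carries a coordinate wedge to the coordinate wedge of the translated family. -/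
theorem galProd_coordWedgeOn {k : ℕ} (g : G) (s : Fin (2 * k) → ι × G) :
    galProd k g (coordWedgeOn (2 * k) s) = coordWedgeOn (2 * k) fun j => ((s j).1, g * (s j).2) := by
  unfold galProd coordWedgeOn
  rw [exteriorPower.map_apply_ιMulti]
  congr 1
  funext j
  rw [Function.comp_apply, galProdLin_coordVecOn]

omit [Fintype G] [Fintype ι] in
/-- The image of the translated family is the simultaneous translate `prodSmul g` of the image. -/
theorem image_translate_eq_prodSmul {n : ℕ} (g : G) (s : Fin n → ι × G) :
    (univ.image fun j => ((s j).1, g * (s j).2)) = prodSmul g (univ.image s) := by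
  ext q
  simp only [mem_image, mem_univ, true_and, mem_prodSmul]
  constructor
  · rintro ⟨j, rfl⟩
    exact ⟨j, by simp⟩
  · rintro ⟨j, hj⟩
    exact ⟨j, by rw [hj]; simp⟩

omit [DecidableEq G] [Fintype G] [Fintype ι] [DecidableEq ι] in
/-- Translating an injective family keeps it injective. -/
theorem translate_injective {n : ℕ} (g : G) {s : Fin n → ι × G} (hs : Function.Injective s) :
    Function.Injective fun j => ((s j).1, g * (s j).2) := by
  intro a b h
  simp only [Prod.mk.injEq, mul_right_inj] at h
  exact hs (Prod.ext h.1 h.2)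

/-- **The `(k, k)`-classes of the product are Galois-stable**: `galProd k g` maps the joint
`λ^k`-eigenspace of the conjugate cocharacters of a family of CM types into itself (the Pohlmann
product wedges are permuted: typer's `IsHodgeSetProd.prodSmul` through typer-2's
`jointEigenspaceOn_prod_eq_span`). -/
theorem map_galProd_jointEigenspaceOn_le {c : G} (hc : IsComplexConj c) {k : ℕ} {T : ι → Finset G}
    (hT : ∀ i, IsCMType c (T i)) (g : G) :
    (jointEigenspaceOn (fun g : G => prodTypeSet fun i => g • T i) (2 * k) k).map (galProd k g) ≤
      jointEigenspaceOn (fun g : G => prodTypeSet fun i => g • T i) (2 * k) k := by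
  rw [jointEigenspaceOn_prod_eq_span hc hT k, Submodule.map_span, Submodule.span_le]
  rintro _ ⟨_, ⟨s, hs, hS, rfl⟩, rfl⟩
  refine Submodule.subset_span ⟨fun j => ((s j).1, g * (s j).2), translate_injective g hs, ?_,
    (galProd_coordWedgeOn g s).symm⟩
  rw [image_translate_eq_prodSmul]
  exact hS.prodSmul g

/-- **Galois-stability, equality form**: `galProd k g` maps the joint eigenspace ONTO itself (`g` and `g⁻¹`). -/
theorem map_galProd_jointEigenspaceOn_eq {c : G} (hc : IsComplexConj c) {k : ℕ} {T : ι → Finset G}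
    (hT : ∀ i, IsCMType c (T i)) (g : G) :
    (jointEigenspaceOn (fun g : G => prodTypeSet fun i => g • T i) (2 * k) k).map (galProd k g) =
      jointEigenspaceOn (fun g : G => prodTypeSet fun i => g • T i) (2 * k) k := by
  refine le_antisymm (map_galProd_jointEigenspaceOn_le hc hT g) ?_
  intro ω hω
  refine ⟨galProd k g⁻¹ ω, map_galProd_jointEigenspaceOn_le hc hT g⁻¹ ⟨ω, hω, rfl⟩, ?_⟩
  rw [← LinearMap.comp_apply, ← galProd_mul, mul_inv_cancel, galProd_one, LinearMap.id_apply]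

/-! ### The Hodge type of a single line: `λ^{m_σ}` with `m_σ = #{i : σ ∈ T i}` -/

omit [Group G] in
/-- The corner count of the `σ`-line in the product type set of `T` is the number of corners containing `σ`. -/
theorem cornerCountOn_prodTypeSet_lineEnum {k : ℕ} (T : ι → Finset G) (e : Fin (2 * k) ≃ ι) (σ : G) :
    cornerCountOn (prodTypeSet T) (lineEnum e σ) = (univ.filter fun i => σ ∈ T i).card := by
  unfold cornerCountOn
  exact Finset.card_equiv e fun j => by simp [lineEnum]

omit [Group G] in
/-- **The Hodge type of the `σ`-line** (Deligne's count): `⋀^{2k} μ_T(λ)` multiplies the `σ`-line by `λ^{m_σ}`,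
`m_σ = #{i : σ ∈ T i}` (the multiplicity of `σ` in `H^{1,0}(B)`): the line has type `(m_σ, 2k − m_σ)`. -/
theorem map_cocharOn_weilWedgeProd {k : ℕ} (T : ι → Finset G) (e : Fin (2 * k) ≃ ι) (σ : G) (lam : ℂ) :
    exteriorPower.map (2 * k) (cocharOn (prodTypeSet T) lam) (weilWedgeProd e σ) =
      lam ^ (univ.filter fun i => σ ∈ T i).card • weilWedgeProd e σ := by
  rw [weilWedgeProd, map_cocharOn_coordWedgeOn, cornerCountOn_prodTypeSet_lineEnum]

omit [Group G] in
/-- The `σ`-line is a `(k, k)`-class for the cocharacter `μ_T` ALONE iff `σ` lies in exactly `k` corners (for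
EVERY conjugate iff every embedding does: `weilSpaceProd_le_jointEigenspaceOn_iff_sumP`). -/
theorem forall_map_cocharOn_weilWedgeProd_eq_iff {k : ℕ} (T : ι → Finset G) (e : Fin (2 * k) ≃ ι) (σ : G) :
    (∀ lam : ℂ, exteriorPower.map (2 * k) (cocharOn (prodTypeSet T) lam) (weilWedgeProd e σ) =
      lam ^ k • weilWedgeProd e σ) ↔ (univ.filter fun i => σ ∈ T i).card = k := by
  rw [weilWedgeProd, forall_map_cocharOn_coordWedgeOn_eq_iff _ (lineEnum_injective e σ),
    cornerCountOn_prodTypeSet_lineEnum]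

omit [Group G] in
/-- `SumP k T` says exactly that every `σ`-line is a `(k, k)`-class for `μ_T` alone: `SumP k T ↔ ∀ σ, m_σ = k`. -/
theorem sumP_iff_forall_map_cocharOn_weilWedgeProd_eq {k : ℕ} (T : ι → Finset G) (e : Fin (2 * k) ≃ ι) :
    SumP k T ↔ ∀ σ : G, ∀ lam : ℂ,
      exteriorPower.map (2 * k) (cocharOn (prodTypeSet T) lam) (weilWedgeProd e σ) =
        lam ^ k • weilWedgeProd e σ := by
  simp only [forall_map_cocharOn_weilWedgeProd_eq_iff]
  rfl

/-! ### Instances: faces on their full four-corner product, the level-3 family `B₃`, the decic witness -/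

/-- **The Weil space of every rank-four face on its FULL four-corner product** (`Fin 4 × G`, the
`2|G|`-fold, no reduction): a `|G|`-dimensional space of joint `(2, 2)`-eigenvectors of every conjugate
cocharacter — the span form of p376653's `face_weilWedgeProd_mem_jointEigenspaceOn`. -/
theorem face_weilSpaceProd_le_jointEigenspaceOn {c : G} (hc : IsComplexConj c) {Φ : Finset G}
    (hΦ : IsCMType c Φ) {π π' : G} (hπ : π' ∉ place c π) :
    weilSpaceProd G 2 (Equiv.refl (Fin (2 * 2))) ≤
      jointEigenspaceOn (fun g : G => prodTypeSet fun i => g • faceCorners c Φ π π' i) (2 * 2) 2 :=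
  weilSpaceProd_le_jointEigenspaceOn hc (isCMType_faceCorners hc hΦ π π')
    (sumP_two_of_sumTwo (sumTwo_faceCorners hc hΦ hπ)) _

omit [Group G] in
/-- The Weil space of a face has dimension `|G|` (`= 8` in degree 8). -/
theorem face_finrank_weilSpaceProd :
    finrank ℂ (weilSpaceProd G 2 (Equiv.refl (Fin (2 * 2)))) = Fintype.card G :=
  finrank_weilSpaceProd (by norm_num) _

/-- **The Weil space of the degree-8 level-3 family `B₃`** (ROUTE.md §3.6 (ii); a repeated corner): inside
the joint `(3, 3)`-eigenspace of every conjugate cocharacter of the 24-fold. -/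
theorem level3Family_weilSpaceProd_le_jointEigenspaceOn {c : G} (hc : IsComplexConj c) {Φ : Finset G}
    (hΦ : IsCMType c Φ) {π : Fin 4 → G} (hπ : IsPlaceEnum c π) :
    weilSpaceProd G 3 (Equiv.refl (Fin (2 * 3))) ≤
      jointEigenspaceOn (fun g : G => prodTypeSet fun i => g • level3Family c Φ π i) (2 * 3) 3 :=
  weilSpaceProd_le_jointEigenspaceOn hc (isCMType_level3Family hc hΦ π)
    (sumP_three_level3Family hc hΦ hπ) _

/-- **typer g5's decic level-3 witness** (`C₁₀`, ROUTE.md §3.6 (iii)): its Weil space (dimension `10`) lies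
in the joint `(3, 3)`-eigenspace of every conjugate cocharacter of the 30-fold. -/
theorem level3Witness_weilSpaceProd_le_jointEigenspaceOn :
    weilSpaceProd C10 3 (Equiv.refl (Fin (2 * 3))) ≤
      jointEigenspaceOn (fun g : C10 => prodTypeSet fun i => g • level3Witness i) (2 * 3) 3 :=
  weilSpaceProd_le_jointEigenspaceOn cc_C10_isComplexConj level3Witness_isCMType
    level3Witness_sumThree _

end HodgeRepro.RouteC
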